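import Summits.QuantumAdvantage.AdviceFreeQNC0.CrossFreeWindow
import Summits.QuantumAdvantage.AdviceFreeQNC0.WalkCoreBasics
import HarnessLib

/-!
# Cell qa-qnc0 (rung F-Q1, route RingFrame, crux α `RingToElim`): the ONE-SIDED FIBRE IDENTITY
# of a window `x ++ h ++ z` (planner qa-qnc0-p1's Sketch11 §23.2, VERBATIM, proved)

THEOREM-TARGET T8 ("two blind spots", planner qa-qnc0-p1 gen 11, ROUND-10 / `Sketch11` §23) in
the planner's own route.  Window `a(p) ++ x(L) ++ h(H) ++ z(M) ++ b(q)` of a walk strategy `y`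
(charge `c`, selectors of degree `≤ D`); the cuts STRICTLY INSIDE the `z`-block do not read `x`.
Fix the outside blocks `a, b` and the middle block `h`.  Then (`oneSidedFibre : OneSidedFibre`,
statement verbatim from `Sketch11` §23.2):

  `WIN(x, z) = e_x(z) ⊕ B_{2|x|}(z)`,

where `e_x` is the WIN pattern of a stakes-eliminator of degree `≤ D` on the `z`-cube
(`IsElimWin D`) and `B_s(z)` — read off the `z`-interior cuts — is a `3`-periodic EVEN triple
(`B_0 ⊕ B_1 ⊕ B_2 ≡ 0`) not depending on `x`.

Mechanism (`mixedWinU_oneSided_eq`): localise to the window (`ringWinU_glue3_eq_mixedWinU`);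
every cut that is NOT strictly inside `z` — the outside triple, the `x`-block cuts, the middle
cuts, the window ends — has a walk character depending on `z` only through `|z| mod 3`
(`nonIntChar`), is live for exactly two residues, and has a selector of degree `≤ D` in `z`; so
these cuts form an even triple `T_r(z)` of degree `D` read at `r = |z| mod 3`, i.e. the complement
of an elimination FAIL pattern (E1 `failCompl_iff_evenTriple`).  The `z`-interior cuts have
character `c' + 2|h| + g + 2|x| + |z| + W_{g−L−H}(z)`: their parity is `B_{2|x|}(z)`.
Nothing is assumed about the `x`-side or middle selectors (contrast `mixedWinU_crossFree_eq_cell`,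
which needs both halves cross-free).

The companion `OneSidedWindowBound.lean` adds Sketch11 §23.3 `ThreeOffsetLemma` and §23.1
`TwoBlindSpotsSqrt` (the density-`1/4` route of the planner).  The flip-orbit route to the same
theorem is prover qa-qnc0-prover gen 6's `TwoBlindSpots*.lean` (`ringWinU_twoBlind_glue3_le`).
The cell's theorem (planner qa-qnc0-p1 gen 11, statement; prover qn-prover-3 gen 4, proof),
2026-08-27; not in print.  WHAT THIS IS NOT: nothing on totally sighted strategies (α proper);
no separation.
-/

noncomputable section

namespace Summit.QuantumAdvantage.AdviceFreeQNC0

open Finset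
open Literature.Computability.MetaComplexity Literature.Computability.MetaComplexity.Smolensky

variable {L H M : ℕ}

/-! ### Small tools -/

/-- Parities add. -/
private theorem decide_odd_add₃ (a b : ℕ) :
    decide ((a + b) % 2 = 1) = xor (decide (a % 2 = 1)) (decide (b % 2 = 1)) := by
  rcases Nat.mod_two_eq_zero_or_one a with ha | ha <;>
    rcases Nat.mod_two_eq_zero_or_one b with hb | hb <;> simp [Nat.add_mod, ha, hb]

/-- Two even triples combine to an even triple. -/
private theorem xor3_pair : ∀ (p0 p1 p2 a0 a1 a2 : Bool),
    xor p0 (xor p1 p2) = false → xor a0 (xor a1 a2) = false →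
    xor (xor p0 a0) (xor (xor p1 a1) (xor p2 a2)) = false := by
  decide

/-! ### The character of a non-interior cut with the `z`-weight as a parameter -/

/-- The walk character, on the window `x ++ h ++ z` at charge `c`, of a cut `g` NOT strictly
inside the `z`-block, with `|z|` replaced by the parameter `r`: an `x`-block cut (`g < L`) sees
`c + g + (|x| + |h| + r) + W_g(x)`, a middle cut (`L ≤ g ≤ L + H`) sees
`c + g + (|x| + |h| + r) + |x| + W_{g−L}(h)`, the window end `g = L + H + M` sees
`c + g + 2(|x| + |h| + r)`. -/
def nonIntChar (L H c : ℕ) (x : Fin L → Bool) (h : Fin H → Bool) (g r : ℕ) : ℕ :=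
  if g < L then c + g + (wt x + wt h + r) + wtPrefix x g
  else if g ≤ L + H then c + g + (wt x + wt h + r) + (wt x + wtPrefix h (g - L))
  else c + g + 2 * (wt x + wt h + r)

/-- Each non-interior cut is live for exactly two of the three residues. -/
theorem nonIntChar_xor3 (L H c : ℕ) (x : Fin L → Bool) (h : Fin H → Bool) (g : ℕ) :
    xor (decide (nonIntChar L H c x h g 0 % 3 ≠ 0)) (xor (decide (nonIntChar L H c x h g 1 % 3 ≠ 0))
      (decide (nonIntChar L H c x h g 2 % 3 ≠ 0))) = false := by
  refine xor3_decide_mod3' _ _ _ ?_ ?_ ?_ <;> unfold nonIntChar <;> split_ifs <;> omega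

/-! ### The one-sided fibre identity on the window -/

/-- **One-sided fibre identity (window form).**  Mixed game on `L + H + M` bits (charge `c`, outside
triple `P`, window strategy `y`) on the content `x ++ h ++ z`, the cuts strictly inside the
`z`-block reading `z` through `sz` only (not `x`; `h` is fixed): the win bit is
`(P_{|w| mod 3} ⊕ N_{|z| mod 3}(z)) ⊕ B_{2|x|}(z)`, where `N_r` is the parity of the
non-interior cuts live for the residue `r` (`nonIntChar`) and `B` the parity of the `z`-interior
cuts with character `c + 2|h| + g + 2|x| + |z| + W_{g−L−H}(z)`. -/
theorem mixedWinU_oneSided_eq (c : ℕ) (P : ℕ → (Fin (L + H + M) → Bool) → Bool)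
    (y : Fin (L + H + M + 1) → (Fin (L + H + M) → Bool) → Bool) (h : Fin H → Bool)
    (sz : Fin (L + H + M + 1) → (Fin M → Bool) → Bool)
    (hz : ∀ g : Fin (L + H + M + 1), L + H < g.val → g.val < L + H + M →
      ∀ (x : Fin L → Bool) (z : Fin M → Bool), y g (glue3 x h z) = sz g z)
    (x : Fin L → Bool) (z : Fin M → Bool) :
    mixedWinU c P y (glue3 x h z) =
      xor (xor (P ((wt x + wt h + wt z % 3) % 3) (glue3 x h z))
            (decide ((((univ : Finset (Fin (L + H + M + 1))).filter fun g =>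
                ¬ (L + H < g.val ∧ g.val < L + H + M)).filter fun g =>
                (y g (glue3 x h z) && decide (nonIntChar L H c x h g.val (wt z % 3) % 3 ≠ 0))
                  = true).card % 2 = 1)))
        (decide ((((univ : Finset (Fin (L + H + M + 1))).filter fun g =>
              L + H < g.val ∧ g.val < L + H + M).filter fun g =>
              (sz g z && decide ((c + 2 * wt h + g.val + 2 * wt x + wt z
                + wtPrefix z (g.val - (L + H))) % 3 ≠ 0)) = true).card % 2 = 1)) := by
  classical
  set w := glue3 x h z with hw
  have hwt : wt w = wt x + wt h + wt z := wt_glue3 x h z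
  set S := univ.filter fun g : Fin (L + H + M + 1) =>
    y g w = true ∧ (c + g.val + walkExp w g.val) % 3 ≠ 0 with hS
  have hsplit : S.card = (S.filter fun g => ¬ (L + H < g.val ∧ g.val < L + H + M)).card
      + (S.filter fun g => L + H < g.val ∧ g.val < L + H + M).card := by
    have hc := Finset.card_filter_add_card_filter_not (s := S)
      (fun g : Fin (L + H + M + 1) => L + H < g.val ∧ g.val < L + H + M)
    omega
  -- non-interior cuts: the character depends on `z` through `|z| mod 3`
  have hN : (S.filter fun g => ¬ (L + H < g.val ∧ g.val < L + H + M)) =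
      ((univ : Finset (Fin (L + H + M + 1))).filter fun g =>
        ¬ (L + H < g.val ∧ g.val < L + H + M)).filter fun g =>
        (y g w && decide (nonIntChar L H c x h g.val (wt z % 3) % 3 ≠ 0)) = true := by
    rw [hS, Finset.filter_filter, Finset.filter_filter]
    refine Finset.filter_congr fun g _ => ?_
    have hchar : ¬ (L + H < g.val ∧ g.val < L + H + M) →
        (c + g.val + walkExp w g.val) % 3 = nonIntChar L H c x h g.val (wt z % 3) % 3 := by
      intro hng
      have hg := g.isLt
      unfold walkExp nonIntChar
      by_cases h1 : g.val < L
      · rw [if_pos h1, hwt, hw, wtPrefix_glue3_of_le x h z (by omega : g.val ≤ L)]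
        omega
      · rw [if_neg h1]
        by_cases h2 : g.val ≤ L + H
        · rw [if_pos h2, hwt]
          have hWg : wtPrefix w g.val = wt x + wtPrefix h (g.val - L) := by
            obtain ⟨d, hd⟩ : ∃ d, g.val = L + d := ⟨g.val - L, by omega⟩
            rw [hw, hd, wtPrefix_glue3_window x h z (by omega : d ≤ H), Nat.add_sub_cancel_left]
          rw [hWg]
          omega
        · rw [if_neg h2, hwt]
          have hgE : g.val = L + H + M := by omega
          rw [hgE, hw, wtPrefix_of_length_le (glue3 x h z) le_rfl, wt_glue3]
          omega
    constructor
    · rintro ⟨⟨h1, h2⟩, h3⟩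
      refine ⟨h3, ?_⟩
      rw [h1, ← hchar h3]
      simp [h2]
    · rintro ⟨h3, h4⟩
      refine ⟨⟨?_, ?_⟩, h3⟩
      · revert h4; cases y g w <;> simp
      · rw [hchar h3]; revert h4; cases y g w <;> simp
  -- interior cuts
  have hB : (S.filter fun g => L + H < g.val ∧ g.val < L + H + M) =
      ((univ : Finset (Fin (L + H + M + 1))).filter fun g =>
        L + H < g.val ∧ g.val < L + H + M).filter fun g =>
        (sz g z && decide ((c + 2 * wt h + g.val + 2 * wt x + wt z
          + wtPrefix z (g.val - (L + H))) % 3 ≠ 0)) = true := by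
    rw [hS, Finset.filter_filter, Finset.filter_filter]
    refine Finset.filter_congr fun g _ => ?_
    have hpre : L + H < g.val → g.val < L + H + M → (c + g.val + walkExp w g.val) % 3 =
        (c + 2 * wt h + g.val + 2 * wt x + wt z + wtPrefix z (g.val - (L + H))) % 3 := by
      intro h1 h2
      unfold walkExp
      rw [hwt, hw, wtPrefix_glue3_of_ge x h z (by omega : L + H ≤ g.val)]
      omega
    constructor
    · rintro ⟨⟨h1, h2⟩, h3, h4⟩
      refine ⟨⟨h3, h4⟩, ?_⟩
      rw [← hz g h3 h4 x z, ← hw, h1, ← hpre h3 h4]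
      simp [h2]
    · rintro ⟨⟨h3, h4⟩, h5⟩
      rw [← hz g h3 h4 x z, ← hw] at h5
      refine ⟨⟨?_, ?_⟩, h3, h4⟩
      · revert h5; cases y g w <;> simp
      · rw [hpre h3 h4]; revert h5; cases y g w <;> simp
  -- assemble
  have hPidx : wt w % 3 = (wt x + wt h + wt z % 3) % 3 := by rw [hwt]; omega
  unfold mixedWinU ringWinU
  rw [hPidx, ← hS, hsplit, decide_odd_add₃, hN, hB]
  generalize P ((wt x + wt h + wt z % 3) % 3) w = bP
  generalize decide ((((univ : Finset (Fin (L + H + M + 1))).filter fun g =>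
      ¬ (L + H < g.val ∧ g.val < L + H + M)).filter fun g =>
      (y g w && decide (nonIntChar L H c x h g.val (wt z % 3) % 3 ≠ 0)) = true).card % 2 = 1) = bN
  generalize decide ((((univ : Finset (Fin (L + H + M + 1))).filter fun g =>
      L + H < g.val ∧ g.val < L + H + M).filter fun g =>
      (sz g z && decide ((c + 2 * wt h + g.val + 2 * wt x + wt z
        + wtPrefix z (g.val - (L + H))) % 3 ≠ 0)) = true).card % 2 = 1) = bB
  cases bP <;> cases bN <;> cases bB <;> rfl

/-! ### Sketch11 §23.2, verbatim, and its proof -/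

/-- **ONE-SIDED FIBRE IDENTITY** (planner qa-qnc0-p1, `Sketch11` §23.2, verbatim).  Fix everything
except `x` and `z`.  If the cuts strictly inside `z` do not read `x`, then for every `x` the
`z`-pattern of WIN is an elimination WIN pattern of degree `D` XOR the fixed pattern `B (2·wt x)`
read off the `z`-interior cuts; `B` is an even `3`-periodic triple. -/
def OneSidedFibre : Prop :=
  ∀ (p L H M q D c : ℕ)
    (y : Fin (p + (L + H + M) + q + 1) → (Fin (p + (L + H + M) + q) → Bool) → Bool),
    (∀ g, HasDeg (y g) D) →
    (∀ g : Fin (p + (L + H + M) + q + 1), p + (L + H) < g.val → g.val < p + (L + H + M) →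
      ∀ (a : Fin p → Bool) (x x' : Fin L → Bool) (h : Fin H → Bool) (z : Fin M → Bool)
        (b : Fin q → Bool), y g (glue3 a (glue3 x h z) b) = y g (glue3 a (glue3 x' h z) b)) →
    ∀ (a : Fin p → Bool) (h : Fin H → Bool) (b : Fin q → Bool),
      ∃ B : ℕ → (Fin M → Bool) → Bool,
        (∀ s z, B (s + 3) z = B s z) ∧
        (∀ s z, xor (B s z) (xor (B (s + 1) z) (B (s + 2) z)) = false) ∧
        ∀ x : Fin L → Bool, ∃ e : (Fin M → Bool) → Bool, IsElimWin D e ∧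
          ∀ z : Fin M → Bool, ringWinU c y (glue3 a (glue3 x h z) b) = xor (e z) (B (2 * wt x) z)

/-- **`OneSidedFibre` holds.**  `B_s(z)` is the parity of the `z`-interior cuts (selectors read
on the fibre with `x := 0`, legitimate by the blindness hypothesis) with character
`c' + 2|h| + g + s + |z| + W_{g−L−H}(z)`, `c' = c + p + 2|a| + |b|`; `e_x(z) = T_{|z| mod 3}(z)`
with `T_r` the outside triple (`outParity`) at `r + |x| + |h|` XOR the parity of the non-interior
cuts live for `r` — an even triple of degree `D`, hence an elimination win pattern (E1). -/
theorem oneSidedFibre : OneSidedFibre := by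
  classical
  intro p L H M q D c y hdeg hZ a h b
  -- the `z`-interior selectors read on the fibre, with `x := 0`
  set sz : Fin (L + H + M + 1) → (Fin M → Bool) → Bool :=
    fun g z => inStrategy y a b g (glue3 (fun _ : Fin L => false) h z) with hsz
  have hsz' : ∀ g : Fin (L + H + M + 1), L + H < g.val → g.val < L + H + M →
      ∀ (x : Fin L → Bool) (z : Fin M → Bool), inStrategy y a b g (glue3 x h z) = sz g z := by
    intro g h1 h2 x z
    rw [hsz]
    unfold inStrategy
    exact hZ ⟨p + g.val, by omega⟩ (show p + (L + H) < p + g.val by omega)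
      (show p + g.val < p + (L + H + M) by omega) a x _ h z b
  refine ⟨fun s z => decide ((((univ : Finset (Fin (L + H + M + 1))).filter fun g =>
      L + H < g.val ∧ g.val < L + H + M).filter fun g =>
      (sz g z && decide ((inCharge c a b + 2 * wt h + g.val + s + wt z
        + wtPrefix z (g.val - (L + H))) % 3 ≠ 0)) = true).card % 2 = 1),
    fun s z => ?_, fun s z => ?_, fun x => ?_⟩
  · -- `3`-periodic
    refine congrArg (fun S : Finset (Fin (L + H + M + 1)) => decide (S.card % 2 = 1))
      (Finset.filter_congr fun g _ => ?_)
    rw [show (inCharge c a b + 2 * wt h + g.val + (s + 3) + wt z + wtPrefix z (g.val - (L + H))) % 3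
      = (inCharge c a b + 2 * wt h + g.val + s + wt z + wtPrefix z (g.val - (L + H))) % 3 by omega]
  · -- even
    exact xor3_parity_of_pointwise _ (fun g => sz g z)
      (fun g => decide ((inCharge c a b + 2 * wt h + g.val + s + wt z
        + wtPrefix z (g.val - (L + H))) % 3 ≠ 0))
      (fun g => decide ((inCharge c a b + 2 * wt h + g.val + (s + 1) + wt z
        + wtPrefix z (g.val - (L + H))) % 3 ≠ 0))
      (fun g => decide ((inCharge c a b + 2 * wt h + g.val + (s + 2) + wt z
        + wtPrefix z (g.val - (L + H))) % 3 ≠ 0))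
      (fun g => xor3_decide_mod3' _ _ _ (by omega) (by omega) (by omega))
  · -- the elimination win pattern `e_x = T_{|z| mod 3}`
    set T : ℕ → (Fin M → Bool) → Bool := fun r z =>
      xor (outParity y c a b ((wt x + wt h + r) % 3) (glue3 x h z))
        (decide ((((univ : Finset (Fin (L + H + M + 1))).filter fun g =>
          ¬ (L + H < g.val ∧ g.val < L + H + M)).filter fun g =>
          (inStrategy y a b g (glue3 x h z) &&
            decide (nonIntChar L H (inCharge c a b) x h g.val r % 3 ≠ 0)) = true).card % 2 = 1))
      with hT
    have hTdeg : ∀ r, HasDeg (T r) D := by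
      intro r
      refine hasDeg_xor (hasDeg_append_right (Fin.append x h) (hasDeg_outParity c y hdeg a b _)) ?_
      exact hasDeg_parity _ (fun g (z : Fin M → Bool) => inStrategy y a b g (glue3 x h z) &&
          decide (nonIntChar L H (inCharge c a b) x h g.val r % 3 ≠ 0))
        fun g _ => hasDeg_and_const'
          (hasDeg_append_right (Fin.append x h) (hasDeg_inStrategy y hdeg a b g)) _
    have hTeven : ∀ z, xor (T 0 z) (xor (T 1 z) (T 2 z)) = false := by
      intro z
      have hP := xor3_perm (fun r => outParity y c a b r (glue3 x h z)) (outParity_even c y a b _)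
        (wt x + wt h + 0) (wt x + wt h + 1) (wt x + wt h + 2) (by omega) (by omega) (by omega)
      have hNp := xor3_parity_of_pointwise (((univ : Finset (Fin (L + H + M + 1))).filter fun g =>
          ¬ (L + H < g.val ∧ g.val < L + H + M)))
        (fun g => inStrategy y a b g (glue3 x h z))
        (fun g => decide (nonIntChar L H (inCharge c a b) x h g.val 0 % 3 ≠ 0))
        (fun g => decide (nonIntChar L H (inCharge c a b) x h g.val 1 % 3 ≠ 0))
        (fun g => decide (nonIntChar L H (inCharge c a b) x h g.val 2 % 3 ≠ 0))
        (fun g => nonIntChar_xor3 L H (inCharge c a b) x h g.val)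
      exact xor3_pair _ _ _ _ _ _ hP hNp
    -- E1: the complement of `T_{|z| mod 3}` is a fail pattern
    have hF : IsElimFail D (fun z => !(T (wt z % 3) z)) :=
      (failCompl_iff_evenTriple M D _).2 ⟨T, ⟨hTdeg, hTeven⟩, fun z => rfl⟩
    obtain ⟨c₀, a', b', ha', hb', hFe⟩ := hF
    refine ⟨fun z => T (wt z % 3) z, ⟨c₀, a', b', ha', hb', fun z => ?_⟩, fun z => ?_⟩
    · rw [← hFe z, Bool.not_not]
    · rw [ringWinU_glue3_eq_mixedWinU c y a (glue3 x h z) b,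
        mixedWinU_oneSided_eq (inCharge c a b) (outParity y c a b) (inStrategy y a b) h sz hsz' x z]

end Summit.QuantumAdvantage.AdviceFreeQNC0
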